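import Summits.Ventures.AbcSig.Levels.N6752P1
import Summits.Ventures.AbcSig.Levels.N6752Q1
import Summits.Ventures.AbcSig.Levels.N6752T2
import Summits.Ventures.AbcSig.Levels.N6752T3

/-!
# Venture AbcSig — GENERATED level file, level 6752 (AGGREGATOR of 4 part files)

HONEST FRAMING. As in the part files `N6752<part>.lean`, parts P1, Q1, T2, T3 (a MIXED split: parts of
different size-splits of the same generator output landed in the tree at different times; every part carries the orbit
blocks of one contiguous run of orbits of the same certified level file `N6752.engine1.json`,
sha256 `2f1dfde4dda99de49fb8ddb3c27dbac64e926a1845809ccd399cd2c945c3e5d7`): this file only concatenates the orbit lists and the part summaries into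
`level6752Orbits`, `level6752_wellformed`, `level6752_sieve` (the shapes the row templates consume). The split exists because the
tree's files are ≤ 400 lines and ≤ 200 000 bytes. Union of residual exponents ≥ 7: [7, 13, 53]; orbits not eliminable by
the sieve: none. No Diophantine statement is made here; no claim on ABC or any summit.
-/

namespace Summit.Ventures.AbcSig

/-- All newform orbits of level 6752 (concatenation of the parts, engine order). -/
def level6752Orbits : List OrbitData :=
  level6752OrbitsP1 ++ level6752OrbitsQ1 ++ level6752OrbitsT2 ++ level6752OrbitsT3

/-- Every listed entry is at an odd prime not dividing 6752. -/
theorem level6752_wellformed :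
    ∀ o ∈ level6752Orbits, ∀ e ∈ o.coeffs, e.ell.Prime ∧ e.ell ≠ 2 ∧ ¬ e.ell ∣ 6752 := by
  unfold level6752Orbits
  exact List.forall_mem_append.2 ⟨List.forall_mem_append.2 ⟨List.forall_mem_append.2 ⟨level6752_wellformedP1, level6752_wellformedQ1⟩, level6752_wellformedT2⟩, level6752_wellformedT3⟩

/-- **Level 6752 summary.** For a prime exponent `n ≥ 7`, every orbit of level 6752 is sieve-eliminated by the
kernel certificates of the part files, except that the row's predicate `X` is assumed for: orbit_6752_1 if n ∈ [7], orbit_6752_2 if n ∈ [7], orbit_6752_9 if n ∈ [7, 13], orbit_6752_10 if n ∈ [7, 13], orbit_6752_11 if n ∈ [7], orbit_6752_12 if n ∈ [7], orbit_6752_17 if n ∈ [53], orbit_6752_18 if n ∈ [53]. -/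
theorem level6752_sieve (n : ℕ) (hn : n.Prime) (hmin : 7 ≤ n) (X : OrbitData → Prop)
    (h_orbit_6752_1 : n ∈ ([7] : List ℕ) → X orbit_6752_1)
    (h_orbit_6752_2 : n ∈ ([7] : List ℕ) → X orbit_6752_2)
    (h_orbit_6752_9 : n ∈ ([7, 13] : List ℕ) → X orbit_6752_9)
    (h_orbit_6752_10 : n ∈ ([7, 13] : List ℕ) → X orbit_6752_10)
    (h_orbit_6752_11 : n ∈ ([7] : List ℕ) → X orbit_6752_11)
    (h_orbit_6752_12 : n ∈ ([7] : List ℕ) → X orbit_6752_12)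
    (h_orbit_6752_17 : n ∈ ([53] : List ℕ) → X orbit_6752_17)
    (h_orbit_6752_18 : n ∈ ([53] : List ℕ) → X orbit_6752_18) :
    ∀ o ∈ level6752Orbits, (∀ e ∈ o.coeffs, e.ell.Prime ∧ e.ell ≠ 2 ∧ ¬ e.ell ∣ 6752) ∧ (o.Eliminated bs04Allowed n ∨ X o) := by
  unfold level6752Orbits
  exact List.forall_mem_append.2 ⟨List.forall_mem_append.2 ⟨List.forall_mem_append.2 ⟨(level6752_sieveP1 n hn hmin X h_orbit_6752_1 h_orbit_6752_2 h_orbit_6752_9), (level6752_sieveQ1 n hn hmin X h_orbit_6752_10 h_orbit_6752_11 h_orbit_6752_12)⟩, (level6752_sieveT2 n hn hmin X)⟩, (level6752_sieveT3 n hn hmin X h_orbit_6752_17 h_orbit_6752_18)⟩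

end Summit.Ventures.AbcSig
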